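import Summits.BirchSwinnertonDyer.BirchSwinnertonDyer.Theses.ByReductionTypeAtTwo
import Summits.BirchSwinnertonDyer.BirchSwinnertonDyer.Theorems.ByReductionTypeAtTwoSupersingularUniformFlatLine
import Summits.BirchSwinnertonDyer.BirchSwinnertonDyer.Theorems.ByReductionTypeAtTwoSupersingularFlatBlindEulerChar
import Summits.BirchSwinnertonDyer.BirchSwinnertonDyer.Theorems.ByReductionTypeAtTwoSupersingularFlatBlindNoCotorsion
import Summits.BirchSwinnertonDyer.BirchSwinnertonDyer.Theorems.ByReductionTypeAtTwoSupersingularFlatBlindLocalTransversalityApZero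
import Summits.BirchSwinnertonDyer.Rank1Residual.F1Sign2.HondaSystemAtTwo
import Summits.BirchSwinnertonDyer.Rank1Residual.Supersingular.BlindControlTwo
import Summits.BirchSwinnertonDyer.Rank1Residual.Supersingular.BlindPointDerivAt
import Summits.BirchSwinnertonDyer.Rank1Residual.P2.EmptyCellsAtTwo
import Literature.NumberTheory.EllipticCurves.PadicFormalLogOrder
import Literature.NumberTheory.EllipticCurves.QuadraticTwist
import Literature.NumberTheory.EllipticCurves.Rank1Residual.Predicates
import Literature.NumberTheory.EllipticCurves.AnalyticRankOrderProofs
import Summits.BirchSwinnertonDyer.BirchSwinnertonDyer.Theorems.ByReductionTypeAtTwoSupersingularFlatBlindLocalTransversality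
import Literature.NumberTheory.EllipticCurves.Sprung2012.LocalTowerLayersProofs
import Literature.NumberTheory.EllipticCurves.Sprung2012.LocalTowerTraceProofs
import HarnessLib

/-!
# D-imc-73 (cell `bsd-f1-sign2`, seat `-imc` g29): THE TREE RECIPE FOR (G) — `w_T` built LAYER BY LAYER from the
# two-generation clauses of `IsHondaSystemAtTwo`, and the kernel-checked reduction (G0) → (G1) → (G2) → (G3) → (G)

HONEST FRAMING.  PUBLISH-ONLY workfile (planner, `ledger crux write`; no registry verb, no proposal); four
`def … : Prop` (nothing asserted about any curve; three of them, (G0), (G2) and (G3), are then PROVED — v2/v3/v4,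
so that the OPEN content of (G) is exactly (G1)), a verbatim copy of (G) `D72BlindGenerator.HondaBlindGeneratorAtTwo`
(crux workfiles are not importable on the farm; the copy is the same term), and sorry-free theorems of pure
bookkeeping (orbit sums only see the orbit; restriction along the layer inclusions; gluing).  Nothing booked; BSD is
proved for no curve.  bears_on: K4 crux `SupersingularRankZeroAtTwo` (item stmt-BirchSwinnertonDyer-19097), slot 5
`stub_CD`, rung CDF±_H via D-imc-72 ★ `(G) → (Y) → CDF±_H` (`D72BlindGenerator.lean`, commit caa7a057f3a7).
MEMO-imc §10.112 (D-imc-73, transport theorem) (4)(α): (G) holds for EVERY legal Honda system in the model, and its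
tree proof needs no Honda point and no End-rigidity — only the clauses of `IsHondaSystemAtTwo`.

## The recipe (MEMO-imc §10.112 (4)(α)), typed

Write `E_n = E(ℚ_{n,v})` (`localLayerPointsOfEmb … n`), `P_n(z; x) = pairingSum … g n x z`, `ω_n = cyclotomicOmega 2 n`,
`u_n = sharpPoly a₂ 2 n`, `Φ_n = Φ_{2^n}(1+T)`.  A functional `z : E_{n+1} → ℤ₂` is a LEVEL-`(n+1)` SOLUTION
(`IsLayerSolution … n z`) when it carries the Coleman data of the pair `(T, 0)` on BOTH generators of `E_{n+1}`:
`ω_{n+1} ∣ P_{n+1}(z; c_{n+1}) + u_{n+1}·T` and `ω_{n+1} ∣ P_{n+1}(z; c_n) + Φ_{n+1}u_n·T` (the second is what the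
first congruence at level `n` becomes when read at level `n+1`: `P_{n+1}(z; c_n) = Φ_{n+1}·P_n(z; c_n)`).

* (G0) `LevelZeroBlindVanishingAtTwo` — a level-`1` solution kills `c_0` (`ω_1 = T(T+2)`, `P_1(z;c_0) = (T+2)·z(c_0)`,
  `u_0 = 0`); **PROVED here** (`levelZeroBlindVanishingAtTwo_holds`, v2 of this file).
* (G1) `LayerwiseBlindSolvabilityAtTwo` — for every `n` a level-`(n+1)` solution EXISTS (size M; the content: the target
  pair `(−u_{n+1}T, −Φ_{n+1}u_nT) mod ω_{n+1}` kills the invariance relations `(g^{2^m} − 1)·[TR-expression of c_m] = 0`,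
  `m ≤ n` — the identities `u_M(χ_j) = B_{M−j}·u_j(χ_j)` of MEMO §10.112 (4)(α) — hence, by torsion-freeness of
  `Λ/ω_{n+1}` and the two dual generation clauses (injectivity + `2`-saturation) of `IsHondaSystemAtTwo`, lies in the
  image of `z ↦ (P_{n+1}(z;c_{n+1}), P_{n+1}(z;c_n))`).
* (G1b) `LayerRankInputAtTwo` (v5) — the structural RANK INPUT the dual-side proof of (G1) consumes: additive surjections
  `E(ℚ_{n+1,v}) ↠ ℤ₂^{2^{n+1}}` for all `n` (textbook: formal group / Lutz–Mattuck; absent from the tree at `p = 2`; the odd-`p`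
  twin is the hypothesis `π` of `Sprung2012.forall_exists_isColemanPair_X_mul_of_surjective`).  (G1) is NOT a consequence of the
  Honda clauses alone — they hold vacuously on a torsion layer — so (G1b) (or an equivalent rank statement) is load-bearing.
* (G2) `LayerwiseBlindRestrictionAtTwo` — a level-`(n+2)` solution restricts to a level-`(n+1)` solution;
  **PROVED here** (v4: `layerwiseBlindRestrictionAtTwo_holds` ⟸ generic `isLayerSolution_restrict`: level raising
  `P_{n+2}(z; c_{n+1}) = Φ_{n+2}·P_{n+1}(z; c_{n+1})` (`pairingSum_succ_of_pow_smul_eq`), cancel `Φ_{n+2} ≠ 0` in the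
  domain `Λ`; trace compatibility `ω_{n+1} ∣ P_{n+2}(z; y) − P_{n+1}(z; y + g^{2^{n+1}}y)` (`omega_dvd_pairingSum_succ_sub`)
  with `y + g^{2^{n+1}}y = Tr_{n+2/n+1} y` (tree `localTraceOfEmb_succ_eq_sum_pow_smul`) and the generic trace relation
  `Tr c_{n+2} = a₂c_{n+1} − c_n`; Sprung's recursion `u_{n+2} = a₂u_{n+1} − Φ_{n+1}u_n` (`sharpPoly_add_two`)).
* (G3) `TowerFunctionalGluingAtTwo` — a family of functionals on the layers compatible under the inclusions is the
  restriction of ONE functional on `E(ℚ_{∞,v})`; **PROVED here** (v3: `towerFunctionalGluingAtTwo_holds`, from the tree's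
  `Sprung2012.exists_mem_localLayerPointsOfEmb_of_mem_localTowerPointsOfEmb` — `E(ℚ_{∞,v}) = ⋃_n E(ℚ_{n,v})`, Kobayashi Def. 1.1).
* ★ `hondaBlindGeneratorAtTwo_of_recipe : (G0) → (G1) → (G2) → (G3) → (G)`, with (G0) discharged
  ★ `hondaBlindGeneratorAtTwo_of_recipe₃ : (G1) → (G2) → (G3) → (G)`, and with (G0), (G3) discharged
  ★ `hondaBlindGeneratorAtTwo_of_recipe₂ : (G1) → (G2) → (G)`, and with (G0), (G2), (G3) discharged
  ★★ `hondaBlindGeneratorAtTwo_of_layerwiseBlindSolvability : (G1) → (G)` (all kernel-checked below): choose level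
  solutions `S n` by (G1); by (G2) and the INJECTIVITY clause of `IsHondaSystemAtTwo` at level `n+1` the restriction of
  `S (n+1)` is `S n`; glue by (G3); the Coleman congruence at level `n+1` is the first congruence of `S n` (orbit sums
  only see the orbit), and at level `0` it is `z(c_0) = 0`, which is (G0).

Why (G1) might fail: only if the model's invariance-relation identities were an artefact of the explicit Honda matrices
rather than of the clauses — they are not (MEMO §10.112 (2): every legal system is `O(E_∞)^×·d` with diagonal unit
first layer; and the relations used are forced by layer membership + the trace clauses alone).  (G2), (G0) are
identities in `Λ` (both proved here); (G3) is topology of the local tower (proved here: the tower is the union of its layers).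

## References
* [Sprung2012] F. Sprung, J. Number Theory 132 (2012): Def. 3.1 (p. 1489), Def. 5.9 (p. 1495), Lemma 2.3 (p. 1487), Prop. 5.5 (p. 1494),
  Open Problem 7.22 (p. 1505); Thm. 2.2 (p. 1487).
* [Sprung2017] F. Sprung, ANT 11 (2017), Cor. 4.4 (the recursion `u_{n+2} = a_p u_{n+1} − Φ_{p^{n+1}}(1+T) u_n`).
* [Kobayashi2003] S. Kobayashi, Invent. Math. 152 (2003), Def. 1.1 (`E(F_{∞,p}) = ⋃_n E(F_{n,p})`, the traces), §8 (Honda theory at `2`).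
* [Silverman2009] J. Silverman, AEC, IV.6.4 / VII.6.3 (formal group of a local field: `Ê(𝔪^r) ≅ 𝔪^r`).
* Tree: `Sprung2012/ColemanMaps.lean` (`pairingSum`, `evalOn`, `IsColemanPair`, `localTowerPointsOfEmb`),
  `Kobayashi2003/SignedSelmer.lean` (`localLayerPointsOfEmb_mono`), `Sprung2012/ColemanMapLambdaActionProofs.lean`
  (`smul_mem_localLayerPointsOfEmb`), `F1Sign2/HondaSystemAtTwo.lean` (`IsHondaSystemAtTwo`),
  `Cruxes/SupersingularRankZeroAtTwo/D72BlindGenerator.lean` (commit caa7a057f3a7).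
-/

set_option autoImplicit false
set_option linter.dupNamespace false
set_option linter.unusedVariables false

noncomputable section

open scoped Classical NumberField
open NumberField IsDedekindDomain WeierstrassCurve PowerSeries
open Literature.NumberTheory.EllipticCurves Literature.NumberTheory.EllipticCurves.IwasawaDual
  Literature.NumberTheory.EllipticCurves.Sprung2012 Literature.NumberTheory.EllipticCurves.Sprung2017
  Literature.NumberTheory.EllipticCurves.Rank1Residual Literature.NumberTheory.EllipticCurves.Rank1Residual.Typed
  Literature.NumberTheory.EllipticCurves.Kobayashi2003 Literature.NumberTheory.GaloisRepresentations ZpExtension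
open Summit.BirchSwinnertonDyer.Rank1Residual Summit.BirchSwinnertonDyer.Rank1Residual.Supersingular
  Summit.BirchSwinnertonDyer.Rank1Residual.Supersingular.BlindLever

namespace Summit.BirchSwinnertonDyer.BirchSwinnertonDyer.Cruxes.SupersingularRankZeroAtTwo

namespace D73GeneratorRecipe

universe u

section Local

variable {K : Type u} [Field K] (κ : ZpExtension K 2) {E : Type u} [Field E] [Algebra K E]
  (ι : AlgebraicClosure K →ₐ[K] AlgebraicClosure E) (W : WeierstrassCurve K)

/-- `IsLayerSolution κ ι W a g c n z`: the functional `z : E_{n+1} → ℤ₂` on the layer `E_{n+1} = E(K_{n+1}·E)` carries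
the Coleman data of the pair `(T, 0)` at level `n+1` on BOTH generators: `ω_{n+1} ∣ P_{n+1}(z; c_{n+1}) + u_{n+1}·T`
and `ω_{n+1} ∣ P_{n+1}(z; c_n) + Φ_{2^{n+1}}(1+T)·u_n·T`.  (Unfolding device of this workfile; nothing asserted.)
[cite: Sprung2012, Def. 3.1 (p. 1489) and Def. 5.9 (p. 1495) (unfolding)] -/
def IsLayerSolution (a : ℤ) (g : Field.absoluteGaloisGroup E) (c : ℕ → localPoints W E) (n : ℕ)
    (z : localLayerPointsOfEmb κ ι W (n + 1) →+ ℤ_[2]) : Prop :=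
  toIwasawa 2 (cyclotomicOmega 2 (n + 1)) ∣
      pairingSum W (localLayerPointsOfEmb κ ι W (n + 1)) g (n + 1) (c (n + 1)) z +
        toIwasawa 2 (sharpPoly a 2 (n + 1)) * PowerSeries.X ∧
  toIwasawa 2 (cyclotomicOmega 2 (n + 1)) ∣
      pairingSum W (localLayerPointsOfEmb κ ι W (n + 1)) g (n + 1) (c n) z +
        toIwasawa 2 ((Polynomial.cyclotomic (2 ^ (n + 1)) ℤ).comp (Polynomial.X + 1) * sharpPoly a 2 n) *
          PowerSeries.X

/-- Orbit sums only see the orbit: if two functionals on two subgroups agree on `{gʲ•x}`, their `P_{n,x}` agree.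
[cite: Sprung2012, Def. 3.1 (p. 1489) (unfolding)] -/
theorem pairingSum_eq_of_forall_apply_eq {A B : AddSubgroup (localPoints W E)} (g : Field.absoluteGaloisGroup E)
    (n : ℕ) (x : localPoints W E) (z : A →+ ℤ_[2]) (z' : B →+ ℤ_[2])
    (h : ∀ j : ℕ, ∃ (ha : g ^ j • x ∈ A) (hb : g ^ j • x ∈ B), z ⟨g ^ j • x, ha⟩ = z' ⟨g ^ j • x, hb⟩) :
    pairingSum W A g n x z = pairingSum W B g n x z' := by
  rw [pairingSum_def, pairingSum_def]
  refine Finset.sum_congr rfl fun j _ => ?_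
  obtain ⟨ha, hb, e⟩ := h j
  rw [evalOn_of_mem W A z ha, evalOn_of_mem W B z' hb, e]

/-- `P_{n,x}` of a difference of functionals. [cite: Sprung2012, Def. 3.1 (p. 1489) ("By linearity")] -/
theorem pairingSum_sub' (A : AddSubgroup (localPoints W E)) (g : Field.absoluteGaloisGroup E) (n : ℕ)
    (x : localPoints W E) (z z' : A →+ ℤ_[2]) :
    pairingSum W A g n x (z - z') = pairingSum W A g n x z - pairingSum W A g n x z' := by
  rw [eq_sub_iff_add_eq, ← pairingSum_add, sub_add_cancel]

/-- The level-one orbit sum of a `g`-FIXED point: `P_{1,x}(z) = z(x)·(1 + (1+T)) = z(x)·(T + 2)`.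
[cite: Sprung2012, Def. 3.1 (p. 1489) (unfolding)] -/
theorem pairingSum_one_of_smul_eq (A : AddSubgroup (localPoints W E)) (g : Field.absoluteGaloisGroup E)
    (x : localPoints W E) (z : A →+ ℤ_[2]) (hx : g • x = x) :
    pairingSum W A g 1 x z = PowerSeries.C (evalOn W A z x) * (PowerSeries.X + PowerSeries.C (2 : ℤ_[2])) := by
  rw [pairingSum_def, pow_one, Finset.sum_range_succ, Finset.sum_range_succ, Finset.sum_range_zero, zero_add,
    pow_zero, pow_zero, one_smul, mul_one, pow_one, pow_one, hx]
  have h2 : (PowerSeries.C (2 : ℤ_[2]) : PowerSeries ℤ_[2]) = 2 := map_ofNat _ 2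
  rw [h2]
  ring

/-- **Level one kills `g`-fixed points in the blind kernel direction** (`p = 2`): if `ω_1 = T(T+2)` divides the
level-one orbit sum `P_{1,x}(z) = z(x)·(T+2)` of a `g`-fixed point `x`, then `z(x) = 0` (cancel `T + 2 ≠ 0` in the
domain `ℤ₂⟦T⟧`, then read the constant coefficient).  [cite: Sprung2012, Def. 7.2 (p. 1500) (`Col_0`)] -/
theorem evalOn_eq_zero_of_omega_one_dvd_pairingSum_one (A : AddSubgroup (localPoints W E))
    (g : Field.absoluteGaloisGroup E) (x : localPoints W E) (z : A →+ ℤ_[2]) (hx : g • x = x)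
    (h : toIwasawa 2 (cyclotomicOmega 2 1) ∣ pairingSum W A g 1 x z) : evalOn W A z x = 0 := by
  rw [Theorems.OddBlindLocal.toIwasawa_cyclotomicOmega_one_two, pairingSum_one_of_smul_eq W A g x z hx] at h
  obtain ⟨q, hq⟩ := h
  have hne : (PowerSeries.X + PowerSeries.C (2 : ℤ_[2]) : PowerSeries ℤ_[2]) ≠ 0 := by
    intro h0
    have h1 := congrArg PowerSeries.constantCoeff h0
    rw [map_add, PowerSeries.constantCoeff_X, PowerSeries.constantCoeff_C, zero_add, map_zero] at h1
    exact two_ne_zero h1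
  have hCe : PowerSeries.C (evalOn W A z x) = PowerSeries.X * q := by
    apply mul_right_cancel₀ hne
    rw [hq]
    ring
  have h1 := congrArg PowerSeries.constantCoeff hCe
  rwa [PowerSeries.constantCoeff_C, map_mul, PowerSeries.constantCoeff_X, zero_mul] at h1

end Local

/-- **(G) — verbatim copy of `D72BlindGenerator.HondaBlindGeneratorAtTwo`** (commit caa7a057f3a7; crux workfiles are
not importable on the farm, the copy is the same term): the Coleman pair `(T, 0)` is realised on every Honda tower at
`a₂ ≠ 0`.  OPEN in the tree; size M.  Nothing asserted.
[cite: Sprung2012, Def. 5.9 (p. 1495), Def. 7.9 (p. 1503), Open Problem 7.22 (p. 1505)] -/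
def HondaBlindGeneratorAtTwo : Prop :=
  ∀ (W : WeierstrassCurve ℚ) [W.IsElliptic] [W.IsGloballyMinimal],
  GoodSS W 2 → W.frobeniusTrace 2 ≠ 0 →
  ∀ (κ : ZpExtension ℚ 2), κ.IsCyclotomic →
  ∀ (v : HeightOneSpectrum (𝓞 ℚ)), (2 : 𝓞 ℚ) ∈ v.asIdeal →
  ∀ (g : Field.absoluteGaloisGroup (v.adicCompletion ℚ)) (c : ℕ → localPoints W (v.adicCompletion ℚ)),
    κ.IsTopGenerator (resGalOfEmb (closureEmb (K := ℚ) (v.adicCompletion ℚ)) g) →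
    (∀ n, c n ∈ localLayerPointsOfEmb κ (closureEmb (K := ℚ) (v.adicCompletion ℚ)) W n) →
    (∃ cneg : localPoints W (v.adicCompletion ℚ),
      Summit.BirchSwinnertonDyer.Rank1Residual.F1Sign2.IsHondaSystemAtTwo κ (closureEmb (K := ℚ) (v.adicCompletion ℚ)) W
        (W.frobeniusTrace 2) g cneg c) →
    ∃ z : localTowerPointsOfEmb κ (closureEmb (K := ℚ) (v.adicCompletion ℚ)) W →+ ℤ_[2],
      IsColemanPair κ (closureEmb (K := ℚ) (v.adicCompletion ℚ)) W (W.frobeniusTrace 2) g c z PowerSeries.X 0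

/-- **(G0) `LevelZeroBlindVanishingAtTwo`** — a level-`1` solution kills the bottom point: for a Honda system `c` at
`2` (`a₂ ≠ 0`) and every additive `z : E(ℚ_{1,v}) → ℤ₂` with the level-`1` Coleman data of `(T, 0)`, `z(c_0) = 0`.
Why true: `c_0` is `g`-fixed, so `P_1(z; c_0) = (T+2)·z(c_0)`, and `u_0 = 0`, `ω_1 = T(T+2)`; cancel `T+2` in the
domain `Λ`.  OPEN in the tree; size S.  Why it might fail: it cannot for a Honda system (pure algebra in `ℤ₂⟦T⟧`);
stated as a Prop only to keep this workfile sorry-free.  Nothing asserted.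
[cite: Sprung2012, Def. 7.2 (p. 1500) (`Col_0`)] -/
def LevelZeroBlindVanishingAtTwo : Prop :=
  ∀ (W : WeierstrassCurve ℚ) [W.IsElliptic] [W.IsGloballyMinimal],
  GoodSS W 2 → W.frobeniusTrace 2 ≠ 0 →
  ∀ (κ : ZpExtension ℚ 2), κ.IsCyclotomic →
  ∀ (v : HeightOneSpectrum (𝓞 ℚ)), (2 : 𝓞 ℚ) ∈ v.asIdeal →
  ∀ (g : Field.absoluteGaloisGroup (v.adicCompletion ℚ)) (c : ℕ → localPoints W (v.adicCompletion ℚ)),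
    κ.IsTopGenerator (resGalOfEmb (closureEmb (K := ℚ) (v.adicCompletion ℚ)) g) →
    (∀ n, c n ∈ localLayerPointsOfEmb κ (closureEmb (K := ℚ) (v.adicCompletion ℚ)) W n) →
    (∃ cneg : localPoints W (v.adicCompletion ℚ),
      Summit.BirchSwinnertonDyer.Rank1Residual.F1Sign2.IsHondaSystemAtTwo κ (closureEmb (K := ℚ) (v.adicCompletion ℚ)) W
        (W.frobeniusTrace 2) g cneg c) →
    ∀ z : localLayerPointsOfEmb κ (closureEmb (K := ℚ) (v.adicCompletion ℚ)) W (0 + 1) →+ ℤ_[2],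
      IsLayerSolution κ (closureEmb (K := ℚ) (v.adicCompletion ℚ)) W (W.frobeniusTrace 2) g c 0 z →
      evalOn W (localLayerPointsOfEmb κ (closureEmb (K := ℚ) (v.adicCompletion ℚ)) W (0 + 1)) z (c 0) = 0

/-- ★ **(G0) holds** — sorry-free: `c_0 ∈ E(ℚ_v)` is `g`-fixed (`mem_localLayerPointsOfEmb_zero_iff`), `u_0 = 0`
(`sharpPoly_zero`), and `evalOn_eq_zero_of_omega_one_dvd_pairingSum_one`.  Only the layer clause `c 0 ∈ E(ℚ_{0,v})`
of the data is used (the Honda hypothesis is not needed). [cite: Sprung2012, Def. 7.2 (p. 1500) (`Col_0`)] -/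
theorem levelZeroBlindVanishingAtTwo_holds : LevelZeroBlindVanishingAtTwo := by
  intro W _ _ hss ha κ hκ v hv g c hg hc hH z hz
  have hfix : g • c 0 = c 0 :=
    (mem_localLayerPointsOfEmb_zero_iff κ (closureEmb (K := ℚ) (v.adicCompletion ℚ)) W (c 0)).1 (hc 0) g
  have h2 := hz.2
  rw [sharpPoly_zero, mul_zero, map_zero, zero_mul, add_zero] at h2
  exact evalOn_eq_zero_of_omega_one_dvd_pairingSum_one W _ g (c 0) z hfix h2

/-- **(G1) `LayerwiseBlindSolvabilityAtTwo`** — the load-bearing step: for a Honda system `c` at `2` (`a₂ ≠ 0`) and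
every `n`, SOME additive `z : E(ℚ_{n+1,v}) → ℤ₂` carries the level-`(n+1)` Coleman data of the pair `(T, 0)` on both
generators `c_{n+1}`, `c_n`.  Why true (MEMO-imc §10.112 (4)(α)): the target pair `(−u_{n+1}T, −Φ_{n+1}u_nT) mod
ω_{n+1}` kills the invariance relations `(g^{2^m} − 1)·[trace expression of c_m in c_{n+1}, c_n] = 0` (`m ≤ n`; forced
by layer membership and the trace clauses) — these are the identities `u_M(χ_j) = B_{M−j}u_j(χ_j)` — and those
relations have finite index in all relations; torsion-freeness of `Λ/ω_{n+1}` and the injectivity + `2`-saturation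
clauses of `IsHondaSystemAtTwo` then put the pair in the image of `z ↦ (P_{n+1}(z;c_{n+1}), P_{n+1}(z;c_n))`.
Model: `z = w_T|_{E_{n+1}}` for EVERY legal system (transport theorem, §10.112 (2)).  OPEN in the tree; size M.
DUAL-SIDE PLAN (MEMO-imc §10.112-add5): with `Im := {(P_{n+1}(z;c_{n+1}), P_{n+1}(z;c_n)) mod ω_{n+1}}` (a `ℤ₂`-submodule of
`Λ_{n+1}²`, `2`-saturated by sat_{n+1}) and `V :=` the pairs killed by the explicit invariance relations: (a) `Im ⊆ V`;
(b) `rank_{ℤ₂} V ≤ 2^{n+1}`; (c) `rank Im ≥ 2^{n+1}` from inj_{n+1} and the RANK INPUT (G1b) below; (d) the target is in `V`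
(the identities); (e) `V/Im` torsion ⟹ `2^k·target ∈ Im` ⟹ target `∈ Im` by saturation.  NOT a consequence of the
`IsHondaSystemAtTwo` clauses alone (they hold vacuously for a torsion layer): the rank input (G1b) is load-bearing.
Why it might fail: only if some invariance identity were an artefact of the explicit Honda matrices rather than of
the clauses (it is not: §10.112 (2)).  Nothing asserted.
[cite: Sprung2012, Def. 5.9 (p. 1495), Open Problem 7.22 (p. 1505)] -/
def LayerwiseBlindSolvabilityAtTwo : Prop :=
  ∀ (W : WeierstrassCurve ℚ) [W.IsElliptic] [W.IsGloballyMinimal],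
  GoodSS W 2 → W.frobeniusTrace 2 ≠ 0 →
  ∀ (κ : ZpExtension ℚ 2), κ.IsCyclotomic →
  ∀ (v : HeightOneSpectrum (𝓞 ℚ)), (2 : 𝓞 ℚ) ∈ v.asIdeal →
  ∀ (g : Field.absoluteGaloisGroup (v.adicCompletion ℚ)) (c : ℕ → localPoints W (v.adicCompletion ℚ)),
    κ.IsTopGenerator (resGalOfEmb (closureEmb (K := ℚ) (v.adicCompletion ℚ)) g) →
    (∀ n, c n ∈ localLayerPointsOfEmb κ (closureEmb (K := ℚ) (v.adicCompletion ℚ)) W n) →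
    (∃ cneg : localPoints W (v.adicCompletion ℚ),
      Summit.BirchSwinnertonDyer.Rank1Residual.F1Sign2.IsHondaSystemAtTwo κ (closureEmb (K := ℚ) (v.adicCompletion ℚ)) W
        (W.frobeniusTrace 2) g cneg c) →
    ∀ n : ℕ, ∃ z : localLayerPointsOfEmb κ (closureEmb (K := ℚ) (v.adicCompletion ℚ)) W (n + 1) →+ ℤ_[2],
      IsLayerSolution κ (closureEmb (K := ℚ) (v.adicCompletion ℚ)) W (W.frobeniusTrace 2) g c n z

/-- **(G1b) `LayerRankInputAtTwo`** — the ONE structural input of the dual-side plan for (G1): every layer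
`E(ℚ_{n+1,v})` of the local cyclotomic `ℤ₂`-tower at `v ∣ 2` surjects additively onto `ℤ₂^{2^{n+1}}` («`E(k)` has
`ℤ₂`-rank `[k : ℚ₂] = 2^{n+1}`»: the formal group `Ê(𝔪_k^r) ≅ 𝔪_k^r` for `r` large, Mattuck / Lutz; Silverman AEC IV.6.4,
VII.6.3).  TEXTBOOK, absent from the tree at `p = 2` — the exact twin of the hypothesis `π` of the odd-`p` tree theorem
`Sprung2012.forall_exists_isColemanPair_X_mul_of_surjective` («the one residual input», `HondaOrbitRankOfSurjectiveProofs`),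
there at the single level `2`, here at every level.  Typed so that -ty / the LEAD can source it (Literature fact or a proof
from the tree's formal-group files `Sprung2012.Honda.*`).  Nothing asserted. [cite: Silverman2009, AEC IV.6.4, VII.6.3]
[cite: Sprung2012, Lemma 2.3 (p. 1487)] -/
def LayerRankInputAtTwo : Prop :=
  ∀ (W : WeierstrassCurve ℚ) [W.IsElliptic] [W.IsGloballyMinimal],
  GoodSS W 2 →
  ∀ (κ : ZpExtension ℚ 2), κ.IsCyclotomic →
  ∀ (v : HeightOneSpectrum (𝓞 ℚ)), (2 : 𝓞 ℚ) ∈ v.asIdeal →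
  ∀ n : ℕ, ∃ π : localLayerPointsOfEmb κ (closureEmb (K := ℚ) (v.adicCompletion ℚ)) W (n + 1) →+ (Fin (2 ^ (n + 1)) → ℤ_[2]),
    Function.Surjective π

/-- **(G2) `LayerwiseBlindRestrictionAtTwo`** — a level-`(n+2)` solution restricts to a level-`(n+1)` solution along
`E(ℚ_{n+1,v}) ≤ E(ℚ_{n+2,v})`.  Why true: `P_{n+2}(z; c_{n+1}) = Φ_{n+2}·P_{n+1}(z; c_{n+1})` (`c_{n+1}` is fixed by
`g^{2^{n+1}}`), cancel `Φ_{n+2}` in the domain `Λ` (`ω_{n+2} = ω_{n+1}Φ_{n+2}`); and `c_n = a₂c_{n+1} − Tr_{n+2/n+1}c_{n+2}`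
(the generic trace clause, `n+1 ≥ 1`) with `P_{n+1}(z; Tr x) ≡ P_{n+2}(z; x) (mod ω_{n+1})` and Sprung's recursion
`u_{n+2} = a₂u_{n+1} − Φ_{n+1}u_n`.  PROVED below (`layerwiseBlindRestrictionAtTwo_holds`, v4).  Nothing asserted
about any curve beyond these identities in `Λ`.
[cite: Sprung2017, Cor. 4.4; Sprung2012, Def. 3.1 (p. 1489)] -/
def LayerwiseBlindRestrictionAtTwo : Prop :=
  ∀ (W : WeierstrassCurve ℚ) [W.IsElliptic] [W.IsGloballyMinimal],
  GoodSS W 2 → W.frobeniusTrace 2 ≠ 0 →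
  ∀ (κ : ZpExtension ℚ 2), κ.IsCyclotomic →
  ∀ (v : HeightOneSpectrum (𝓞 ℚ)), (2 : 𝓞 ℚ) ∈ v.asIdeal →
  ∀ (g : Field.absoluteGaloisGroup (v.adicCompletion ℚ)) (c : ℕ → localPoints W (v.adicCompletion ℚ)),
    κ.IsTopGenerator (resGalOfEmb (closureEmb (K := ℚ) (v.adicCompletion ℚ)) g) →
    (∀ n, c n ∈ localLayerPointsOfEmb κ (closureEmb (K := ℚ) (v.adicCompletion ℚ)) W n) →
    (∃ cneg : localPoints W (v.adicCompletion ℚ),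
      Summit.BirchSwinnertonDyer.Rank1Residual.F1Sign2.IsHondaSystemAtTwo κ (closureEmb (K := ℚ) (v.adicCompletion ℚ)) W
        (W.frobeniusTrace 2) g cneg c) →
    ∀ (n : ℕ) (z : localLayerPointsOfEmb κ (closureEmb (K := ℚ) (v.adicCompletion ℚ)) W (n + 1 + 1) →+ ℤ_[2]),
      IsLayerSolution κ (closureEmb (K := ℚ) (v.adicCompletion ℚ)) W (W.frobeniusTrace 2) g c (n + 1) z →
      IsLayerSolution κ (closureEmb (K := ℚ) (v.adicCompletion ℚ)) W (W.frobeniusTrace 2) g c n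
        (z.comp (AddSubgroup.inclusion
          (localLayerPointsOfEmb_mono κ (closureEmb (K := ℚ) (v.adicCompletion ℚ)) W (Nat.le_succ (n + 1)))))

/-- **(G3) `TowerFunctionalGluingAtTwo`** — functionals on the layers `E(ℚ_{n,v})`, compatible under the inclusions
`E(ℚ_{n,v}) ≤ E(ℚ_{n+1,v})`, are the restrictions of ONE additive functional on `E(ℚ_{∞,v})`.  Why true:
`E(ℚ_{∞,v}) = ⋃_n E(ℚ_{n,v})` (stabilisers of algebraic points are open and contain `Gal(ℚ̄_v/ℚ_{∞,v})`, hence some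
`Gal(ℚ̄_v/ℚ_{n,v})`: the definition of `E(F_{∞,p})`, Kobayashi 2003 Def. 1.1 — folklore; the tree lemma carries Sprung's Lemma
7.10 tag), and a compatible family on a directed union defines a map on the union.
OPEN in the tree (the tree has `localLayerPointsOfEmb_le_localTowerPointsOfEmb`, not yet the union); size S–M.
Why it might fail: it cannot (topology of the local tower); a Prop only to keep this workfile sorry-free.
Nothing asserted. [cite: Kobayashi2003, Def. 1.1 (E(F_{∞,p}) = ⋃ E(F_{n,p}))] [folklore] -/
def TowerFunctionalGluingAtTwo : Prop :=
  ∀ (W : WeierstrassCurve ℚ) (κ : ZpExtension ℚ 2) (v : HeightOneSpectrum (𝓞 ℚ))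
    (Z : (n : ℕ) → (localLayerPointsOfEmb κ (closureEmb (K := ℚ) (v.adicCompletion ℚ)) W n →+ ℤ_[2])),
    (∀ n, (Z (n + 1)).comp (AddSubgroup.inclusion
        (localLayerPointsOfEmb_mono κ (closureEmb (K := ℚ) (v.adicCompletion ℚ)) W (Nat.le_succ n))) = Z n) →
    ∃ z : localTowerPointsOfEmb κ (closureEmb (K := ℚ) (v.adicCompletion ℚ)) W →+ ℤ_[2],
      ∀ n, z.comp (AddSubgroup.inclusion
        (localLayerPointsOfEmb_le_localTowerPointsOfEmb κ (closureEmb (K := ℚ) (v.adicCompletion ℚ)) W n)) = Z n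

section Gluing

variable {K : Type u} [Field K] (κ : ZpExtension K 2) {E : Type u} [Field E] [Algebra K E]
  (ι : AlgebraicClosure K →ₐ[K] AlgebraicClosure E) (W : WeierstrassCurve K)

/-- **Gluing along the local tower** (generic base): additive functionals on the layers `E(K_n·E)`, compatible under
the inclusions `E(K_n·E) ≤ E(K_{n+1}·E)`, are the restrictions of ONE additive functional on `E(K_∞·E)` — because the
tower is the union of its layers (tree `Sprung2012.exists_mem_localLayerPointsOfEmb_of_mem_localTowerPointsOfEmb`,
open stabilisers + compactness; Kobayashi 2003 Def. 1.1).  [cite: Kobayashi2003, Def. 1.1 (E(F_{∞,p}))] [folklore] -/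
theorem exists_addMonoidHom_localTowerPointsOfEmb_comp_inclusion_eq
    (Z : (n : ℕ) → (localLayerPointsOfEmb κ ι W n →+ ℤ_[2]))
    (hZ : ∀ n, (Z (n + 1)).comp (AddSubgroup.inclusion (localLayerPointsOfEmb_mono κ ι W (Nat.le_succ n))) = Z n) :
    ∃ z : localTowerPointsOfEmb κ ι W →+ ℤ_[2],
      ∀ n, z.comp (AddSubgroup.inclusion (localLayerPointsOfEmb_le_localTowerPointsOfEmb κ ι W n)) = Z n := by
  classical
  -- compatibility along `m ≤ n`
  have hZle : ∀ {m n : ℕ} (h : m ≤ n) (x : localPoints W E) (hx : x ∈ localLayerPointsOfEmb κ ι W m),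
      Z n ⟨x, localLayerPointsOfEmb_mono κ ι W h hx⟩ = Z m ⟨x, hx⟩ := by
    intro m n h x hx
    induction h with
    | refl => rfl
    | step h ih =>
      have e := DFunLike.congr_fun (hZ _) ⟨x, localLayerPointsOfEmb_mono κ ι W h hx⟩
      rw [AddMonoidHom.comp_apply] at e
      exact e.trans ih
  -- every tower point lies in some layer
  have hex : ∀ P : localTowerPointsOfEmb κ ι W, ∃ n, (P : localPoints W E) ∈ localLayerPointsOfEmb κ ι W n :=
    fun P => exists_mem_localLayerPointsOfEmb_of_mem_localTowerPointsOfEmb κ ι W P.2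
  choose N hN using hex
  let f : localTowerPointsOfEmb κ ι W → ℤ_[2] := fun P => Z (N P) ⟨P, hN P⟩
  have hf : ∀ (P : localTowerPointsOfEmb κ ι W) (n : ℕ) (hP : (P : localPoints W E) ∈ localLayerPointsOfEmb κ ι W n),
      f P = Z n ⟨P, hP⟩ := by
    intro P n hP
    have e1 := hZle (le_max_left (N P) n) (P : localPoints W E) (hN P)
    have e2 := hZle (le_max_right (N P) n) (P : localPoints W E) hP
    exact e1.symm.trans e2
  refine ⟨{ toFun := f, map_zero' := ?_, map_add' := ?_ }, ?_⟩
  · rw [hf 0 0 (zero_mem _)]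
    exact map_zero (Z 0)
  · intro P Q
    have hP : (P : localPoints W E) ∈ localLayerPointsOfEmb κ ι W (max (N P) (N Q)) :=
      localLayerPointsOfEmb_mono κ ι W (le_max_left _ _) (hN P)
    have hQ : (Q : localPoints W E) ∈ localLayerPointsOfEmb κ ι W (max (N P) (N Q)) :=
      localLayerPointsOfEmb_mono κ ι W (le_max_right _ _) (hN Q)
    have hPQ : ((P + Q : localTowerPointsOfEmb κ ι W) : localPoints W E) ∈
        localLayerPointsOfEmb κ ι W (max (N P) (N Q)) := add_mem hP hQ
    rw [hf (P + Q) _ hPQ, hf P _ hP, hf Q _ hQ, ← map_add]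
    rfl
  · intro n
    ext x
    rw [AddMonoidHom.comp_apply]
    exact hf ⟨x, localLayerPointsOfEmb_le_localTowerPointsOfEmb κ ι W n x.2⟩ n x.2

end Gluing

section Restriction

variable {K : Type u} [Field K] (κ : ZpExtension K 2) {E : Type u} [Field E] [Algebra K E]
  (ι : AlgebraicClosure K →ₐ[K] AlgebraicClosure E) (W : WeierstrassCurve K)

/-! ### Small algebra in `Λ = ℤ₂⟦T⟧` at `p = 2` -/

/-- `T ↦ T` under `ℤ[T] → Λ`. [folklore] -/
theorem toIwasawa_X_two : toIwasawa 2 (Polynomial.X : Polynomial ℤ) = PowerSeries.X := by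
  show (((Polynomial.X : Polynomial ℤ).map (Int.castRingHom ℤ_[2]) : Polynomial ℤ_[2]) : PowerSeries ℤ_[2]) =
    PowerSeries.X
  rw [Polynomial.map_X, Polynomial.coe_X]

/-- `C a ↦ C a` under `ℤ[T] → Λ`. [folklore] -/
theorem toIwasawa_C_two (a : ℤ) : toIwasawa 2 (Polynomial.C a) = PowerSeries.C (a : ℤ_[2]) := by
  show (((Polynomial.C a : Polynomial ℤ).map (Int.castRingHom ℤ_[2]) : Polynomial ℤ_[2]) : PowerSeries ℤ_[2]) =
    PowerSeries.C (a : ℤ_[2])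
  rw [Polynomial.map_C, Polynomial.coe_C]
  simp

/-- `Φ_{2^{m+1}}(1+T) = 1 + (1+T)^{2^m}` in `Λ`. [folklore] -/
theorem toIwasawa_cyclotomic_comp_two (m : ℕ) :
    toIwasawa 2 ((Polynomial.cyclotomic (2 ^ (m + 1)) ℤ).comp (Polynomial.X + 1)) =
      1 + (1 + PowerSeries.X) ^ 2 ^ m := by
  rw [Polynomial.cyclotomic_prime_pow_eq_geom_sum (Fact.out : (2 : ℕ).Prime)]
  simp only [Finset.sum_range_succ, Finset.sum_range_zero, zero_add, pow_zero, pow_one, Polynomial.add_comp,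
    Polynomial.one_comp, Polynomial.pow_comp, Polynomial.X_comp, map_add, map_one, map_pow, toIwasawa_X_two]
  ring

/-- `Φ_{2^{m+1}}(1+T) ≠ 0` in the domain `Λ` (constant term `2`). [folklore] -/
theorem toIwasawa_cyclotomic_comp_two_ne_zero (m : ℕ) :
    toIwasawa 2 ((Polynomial.cyclotomic (2 ^ (m + 1)) ℤ).comp (Polynomial.X + 1)) ≠ 0 := by
  rw [toIwasawa_cyclotomic_comp_two]
  intro h
  have h1 := congrArg PowerSeries.constantCoeff h
  rw [map_add, map_one, map_pow, map_add, map_one, PowerSeries.constantCoeff_X, add_zero, one_pow, map_zero] at h1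
  norm_num at h1

/-- `ω_{m+1} = ω_m · Φ_{2^{m+1}}(1+T)` in `Λ`. [cite: Pollack2003, Thm. 6.17 (ω_n = (1+T)^{p^n} − 1)] -/
theorem toIwasawa_cyclotomicOmega_succ_two (m : ℕ) :
    toIwasawa 2 (cyclotomicOmega 2 (m + 1)) =
      toIwasawa 2 (cyclotomicOmega 2 m) * toIwasawa 2 ((Polynomial.cyclotomic (2 ^ (m + 1)) ℤ).comp (Polynomial.X + 1)) := by
  rw [toIwasawa_cyclotomicOmega, toIwasawa_cyclotomicOmega, toIwasawa_cyclotomic_comp_two, pow_succ, pow_mul]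
  ring

/-! ### Orbit sums: level raising, trace compatibility, additivity in the point (layer-functional form at `p = 2`) -/

/-- **Level raising** (layer-functional form of Sprung's `P_{n+1,x} = Φ·P_{n,x}`, tree
`Sprung2012.thetaPoly_succ_of_mem_layer` for tower functionals): if `g^{2^m}` fixes `x`, then
`P_{m+1,x}(z) = Φ_{2^{m+1}}(1+T)·P_{m,x}(z)`. [cite: Sprung2012, Prop. 5.5 (p. 1494)] -/
theorem pairingSum_succ_of_pow_smul_eq (A : AddSubgroup (localPoints W E)) (g : Field.absoluteGaloisGroup E) (m : ℕ)
    (x : localPoints W E) (z : A →+ ℤ_[2]) (hx : g ^ 2 ^ m • x = x) :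
    pairingSum W A g (m + 1) x z =
      toIwasawa 2 ((Polynomial.cyclotomic (2 ^ (m + 1)) ℤ).comp (Polynomial.X + 1)) * pairingSum W A g m x z := by
  rw [toIwasawa_cyclotomic_comp_two, pairingSum_def, pairingSum_def, pow_succ, mul_two, Finset.sum_range_add]
  have h2 : ∑ j ∈ Finset.range (2 ^ m),
      PowerSeries.C (evalOn W A z (g ^ (2 ^ m + j) • x)) * (1 + PowerSeries.X) ^ (2 ^ m + j) =
      (1 + PowerSeries.X) ^ 2 ^ m *
        ∑ j ∈ Finset.range (2 ^ m), PowerSeries.C (evalOn W A z (g ^ j • x)) * (1 + PowerSeries.X) ^ j := by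
    rw [Finset.mul_sum]
    refine Finset.sum_congr rfl fun j _ => ?_
    rw [add_comm (2 ^ m) j, pow_add g j (2 ^ m), mul_smul, hx, pow_add (1 + PowerSeries.X) j (2 ^ m)]
    ring
  rw [h2]
  ring

/-- **Trace compatibility** (layer-functional form of tree `Sprung2012.omega_dvd_thetaPoly_succ_sub`): for `y` whose
Galois translates lie in `A`, `ω_m ∣ P_{m+1,y}(z) − P_{m, y + g^{2^m}y}(z)` — and `y + g^{2^m}y = Tr_{m+1/m} y` for `y`
of level `m+1` (`localTraceOfEmb_succ_eq_sum_pow_smul` at `p = 2`). [cite: Sprung2012, Prop. 5.5 (p. 1494)]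
[cite: Kobayashi2003, Lemma 8.15] -/
theorem omega_dvd_pairingSum_succ_sub (A : AddSubgroup (localPoints W E)) (g : Field.absoluteGaloisGroup E) (m : ℕ)
    (y : localPoints W E) (z : A →+ ℤ_[2]) (hy : ∀ σ : Field.absoluteGaloisGroup E, σ • y ∈ A) :
    toIwasawa 2 (cyclotomicOmega 2 m) ∣
      pairingSum W A g (m + 1) y z - pairingSum W A g m (y + g ^ 2 ^ m • y) z := by
  rw [toIwasawa_cyclotomicOmega, pairingSum_def, pairingSum_def, pow_succ, mul_two, Finset.sum_range_add]
  have h : ∀ j : ℕ, evalOn W A z (g ^ j • (y + g ^ 2 ^ m • y)) =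
      evalOn W A z (g ^ j • y) + evalOn W A z (g ^ (2 ^ m + j) • y) := by
    intro j
    have hP : g ^ j • y ∈ A := hy _
    have hQ : g ^ (2 ^ m + j) • y ∈ A := hy _
    rw [smul_add, ← mul_smul, ← pow_add, add_comm j (2 ^ m), evalOn_of_mem W A z (add_mem hP hQ),
      evalOn_of_mem W A z hP, evalOn_of_mem W A z hQ]
    exact map_add z ⟨_, hP⟩ ⟨_, hQ⟩
  simp_rw [h, map_add, add_mul, Finset.sum_add_distrib]
  rw [show ∀ a b c : IwasawaAlgebra 2, a + b - (a + c) = b - c from fun a b c => by ring, ← Finset.sum_sub_distrib]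
  refine Finset.dvd_sum fun j _ => ?_
  rw [pow_add (1 + PowerSeries.X) (2 ^ m) j]
  exact ⟨PowerSeries.C (evalOn W A z (g ^ (2 ^ m + j) • y)) * (1 + PowerSeries.X) ^ j, by ring⟩

/-- `P_{m,x}(z)` is additive in the POINT `x` (for points whose Galois translates lie in `A`): subtraction.
[cite: Sprung2012, Def. 3.1 (p. 1489) ("By linearity")] -/
theorem pairingSum_point_sub (A : AddSubgroup (localPoints W E)) (g : Field.absoluteGaloisGroup E) (m : ℕ)
    {x y : localPoints W E} (z : A →+ ℤ_[2]) (hx : ∀ σ : Field.absoluteGaloisGroup E, σ • x ∈ A)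
    (hy : ∀ σ : Field.absoluteGaloisGroup E, σ • y ∈ A) :
    pairingSum W A g m (x - y) z = pairingSum W A g m x z - pairingSum W A g m y z := by
  rw [pairingSum_def, pairingSum_def, pairingSum_def, ← Finset.sum_sub_distrib]
  refine Finset.sum_congr rfl fun j _ => ?_
  rw [smul_sub, evalOn_of_mem W A z (sub_mem (hx _) (hy _)), evalOn_of_mem W A z (hx _),
    evalOn_of_mem W A z (hy _), ← sub_mul, ← map_sub]
  congr 2
  exact map_sub z ⟨_, hx _⟩ ⟨_, hy _⟩

/-- `P_{m,x}(z)` is `ℤ`-linear in the POINT `x`: `P_{m, k•x} = k·P_{m,x}`.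
[cite: Sprung2012, Def. 3.1 (p. 1489) ("By linearity")] -/
theorem pairingSum_point_zsmul (A : AddSubgroup (localPoints W E)) (g : Field.absoluteGaloisGroup E) (m : ℕ)
    {x : localPoints W E} (z : A →+ ℤ_[2]) (hx : ∀ σ : Field.absoluteGaloisGroup E, σ • x ∈ A) (k : ℤ) :
    pairingSum W A g m (k • x) z = PowerSeries.C (k : ℤ_[2]) * pairingSum W A g m x z := by
  rw [pairingSum_def, pairingSum_def, Finset.mul_sum]
  refine Finset.sum_congr rfl fun j _ => ?_
  have e : g ^ j • (k • x) = k • (g ^ j • x) := map_zsmul (DistribSMul.toAddMonoidHom (localPoints W E) (g ^ j)) k x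
  rw [e, evalOn_of_mem W A z (zsmul_mem (hx _) k), evalOn_of_mem W A z (hx _)]
  have e2 : z ⟨k • (g ^ j • x), zsmul_mem (hx _) k⟩ = (k : ℤ_[2]) * z ⟨g ^ j • x, hx _⟩ := by
    rw [← zsmul_eq_mul]
    exact map_zsmul z k ⟨_, hx _⟩
  rw [e2, map_mul]
  ring

/-- **(G2), generic local form**: restriction of a layer solution along `E_{n+1} ≤ E_{n+2}` is a layer solution,
given ONE trace relation `Tr_{n+2/n+1} c_{n+2} = a c_{n+1} − c_n` (level raising + trace compatibility + Sprung's
recursion `u_{n+2} = a u_{n+1} − Φ_{n+1} u_n`; cancel `Φ_{n+2} ≠ 0` in the domain `Λ`).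
[cite: Sprung2012, Prop. 5.5 (p. 1494), Def. 5.9 (p. 1495)] [cite: Sprung2017, Cor. 4.4] -/
theorem isLayerSolution_restrict {a : ℤ} {g : Field.absoluteGaloisGroup E} (hg : κ.IsTopGenerator (resGalOfEmb ι g))
    {c : ℕ → localPoints W E} (hc : ∀ n, c n ∈ localLayerPointsOfEmb κ ι W n) (n : ℕ)
    (hTR : localTraceOfEmb κ ι W (n + 1) (n + 1 + 1) (c (n + 1 + 1)) = a • c (n + 1) - c n)
    (z : localLayerPointsOfEmb κ ι W (n + 1 + 1) →+ ℤ_[2]) (hz : IsLayerSolution κ ι W a g c (n + 1) z) :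
    IsLayerSolution κ ι W a g c n
      (z.comp (AddSubgroup.inclusion (localLayerPointsOfEmb_mono κ ι W (Nat.le_succ (n + 1))))) := by
  -- Galois translates of the `c m` live in the layers
  have hA : ∀ (m : ℕ), m ≤ n + 1 + 1 → ∀ σ : Field.absoluteGaloisGroup E,
      σ • c m ∈ localLayerPointsOfEmb κ ι W (n + 1 + 1) := fun m hm σ =>
    smul_mem_localLayerPointsOfEmb κ ι W (n + 1 + 1) σ (localLayerPointsOfEmb_mono κ ι W hm (hc m))
  have hB : ∀ (m : ℕ), m ≤ n + 1 → ∀ σ : Field.absoluteGaloisGroup E,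
      σ • c m ∈ localLayerPointsOfEmb κ ι W (n + 1) := fun m hm σ =>
    smul_mem_localLayerPointsOfEmb κ ι W (n + 1) σ (localLayerPointsOfEmb_mono κ ι W hm (hc m))
  -- transfer: orbit sums of the restricted functional are those of `z`
  have htr : ∀ x : localPoints W E, (∀ σ : Field.absoluteGaloisGroup E, σ • x ∈ localLayerPointsOfEmb κ ι W (n + 1)) →
      pairingSum W (localLayerPointsOfEmb κ ι W (n + 1)) g (n + 1) x
          (z.comp (AddSubgroup.inclusion (localLayerPointsOfEmb_mono κ ι W (Nat.le_succ (n + 1))))) =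
        pairingSum W (localLayerPointsOfEmb κ ι W (n + 1 + 1)) g (n + 1) x z := by
    intro x hx
    exact pairingSum_eq_of_forall_apply_eq W g (n + 1) x _ _ fun j =>
      ⟨hx _, localLayerPointsOfEmb_mono κ ι W (Nat.le_succ (n + 1)) (hx _), rfl⟩
  obtain ⟨hz1, hz2⟩ := hz
  -- `ω_{n+2} = ω_{n+1} Φ_{n+2}`; level raising for `c (n+1)` (fixed by `g^{2^{n+1}}`)
  have hfix : g ^ 2 ^ (n + 1) • c (n + 1) = c (n + 1) := by
    have h := pow_mul_smul_of_mem_localLayerPointsOfEmb κ ι W hg (hc (n + 1)) 1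
    rwa [mul_one] at h
  rw [toIwasawa_cyclotomicOmega_succ_two] at hz1 hz2
  rw [pairingSum_succ_of_pow_smul_eq W _ g (n + 1) (c (n + 1)) z hfix, map_mul] at hz2
  have hΦ := toIwasawa_cyclotomic_comp_two_ne_zero (n + 1)
  -- (i') `ω_{n+1} ∣ P_{n+1}(z; c_{n+1}) + u_{n+1} T`
  have h1' : toIwasawa 2 (cyclotomicOmega 2 (n + 1)) ∣
      pairingSum W (localLayerPointsOfEmb κ ι W (n + 1 + 1)) g (n + 1) (c (n + 1)) z +
        toIwasawa 2 (sharpPoly a 2 (n + 1)) * PowerSeries.X := by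
    obtain ⟨q, hq⟩ := hz2
    refine (mul_dvd_mul_iff_left hΦ).mp ⟨q, ?_⟩
    linear_combination hq
  -- `ω_{n+1} ∣ P_{n+2}(z; c_{n+2}) + u_{n+2} T`
  have h0 : toIwasawa 2 (cyclotomicOmega 2 (n + 1)) ∣
      pairingSum W (localLayerPointsOfEmb κ ι W (n + 1 + 1)) g (n + 1 + 1) (c (n + 1 + 1)) z +
        toIwasawa 2 (sharpPoly a 2 (n + 1 + 1)) * PowerSeries.X := (dvd_mul_right _ _).trans hz1
  -- trace compatibility + the trace relation
  have htrace : c (n + 1 + 1) + g ^ 2 ^ (n + 1) • c (n + 1 + 1) = a • c (n + 1) - c n := by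
    rw [← hTR, localTraceOfEmb_succ_eq_sum_pow_smul κ ι W hg (n + 1) (hc (n + 1 + 1))]
    simp [Finset.sum_range_succ]
  have hTC := omega_dvd_pairingSum_succ_sub W (localLayerPointsOfEmb κ ι W (n + 1 + 1)) g (n + 1) (c (n + 1 + 1)) z
    (hA (n + 1 + 1) le_rfl)
  have hax : ∀ σ : Field.absoluteGaloisGroup E, σ • (a • c (n + 1)) ∈ localLayerPointsOfEmb κ ι W (n + 1 + 1) :=
    fun σ => smul_mem_localLayerPointsOfEmb κ ι W (n + 1 + 1) σ
      (localLayerPointsOfEmb_mono κ ι W (Nat.le_succ (n + 1)) (zsmul_mem (hc (n + 1)) a))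
  rw [htrace, pairingSum_point_sub W _ g (n + 1) z hax (hA n (by omega)),
    pairingSum_point_zsmul W _ g (n + 1) z (hA (n + 1) (Nat.le_succ _)) a] at hTC
  -- Sprung's recursion `u_{n+2} = a u_{n+1} − Φ_{n+1} u_n` in `Λ`
  have hrec : toIwasawa 2 (sharpPoly a 2 (n + 1 + 1)) =
      PowerSeries.C (a : ℤ_[2]) * toIwasawa 2 (sharpPoly a 2 (n + 1)) -
        toIwasawa 2 ((Polynomial.cyclotomic (2 ^ (n + 1)) ℤ).comp (Polynomial.X + 1)) *
          toIwasawa 2 (sharpPoly a 2 n) := by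
    rw [(sharpPoly_add_two a 2 n : sharpPoly a 2 (n + 1 + 1) = _), map_sub, map_mul, map_mul, toIwasawa_C_two]
  refine ⟨?_, ?_⟩
  · rw [htr _ (hB (n + 1) le_rfl)]
    exact h1'
  · rw [htr _ (hB n (Nat.le_succ n)), map_mul]
    have key :
        pairingSum W (localLayerPointsOfEmb κ ι W (n + 1 + 1)) g (n + 1) (c n) z +
            toIwasawa 2 ((Polynomial.cyclotomic (2 ^ (n + 1)) ℤ).comp (Polynomial.X + 1)) *
              toIwasawa 2 (sharpPoly a 2 n) * PowerSeries.X =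
          PowerSeries.C (a : ℤ_[2]) *
              (pairingSum W (localLayerPointsOfEmb κ ι W (n + 1 + 1)) g (n + 1) (c (n + 1)) z +
                toIwasawa 2 (sharpPoly a 2 (n + 1)) * PowerSeries.X) -
            (pairingSum W (localLayerPointsOfEmb κ ι W (n + 1 + 1)) g (n + 1 + 1) (c (n + 1 + 1)) z +
              toIwasawa 2 (sharpPoly a 2 (n + 1 + 1)) * PowerSeries.X) +
            (pairingSum W (localLayerPointsOfEmb κ ι W (n + 1 + 1)) g (n + 1 + 1) (c (n + 1 + 1)) z -
              (PowerSeries.C (a : ℤ_[2]) *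
                  pairingSum W (localLayerPointsOfEmb κ ι W (n + 1 + 1)) g (n + 1) (c (n + 1)) z -
                pairingSum W (localLayerPointsOfEmb κ ι W (n + 1 + 1)) g (n + 1) (c n) z)) := by
      rw [hrec]
      ring
    rw [key]
    exact dvd_add (dvd_sub (dvd_mul_of_dvd_right h1' _) h0) hTC

end Restriction

/-- ★ **(G3) holds** — sorry-free, by `exists_addMonoidHom_localTowerPointsOfEmb_comp_inclusion_eq` (the tower is the union of
its layers, tree `Sprung2012.LocalTowerLayersProofs`). [cite: Kobayashi2003, Def. 1.1 (E(F_{∞,p}))] [folklore] -/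
theorem towerFunctionalGluingAtTwo_holds : TowerFunctionalGluingAtTwo :=
  fun W κ v Z hZ =>
    exists_addMonoidHom_localTowerPointsOfEmb_comp_inclusion_eq κ (closureEmb (K := ℚ) (v.adicCompletion ℚ)) W Z hZ

/-- ★ **The kernel-checked reduction (G0) → (G1) → (G2) → (G3) → (G).**  Choose level solutions `S n : E_{n+1} → ℤ₂`
by (G1); (G2) and the INJECTIVITY clause of `IsHondaSystemAtTwo` at level `n+1` (applied to the difference) force
`S (n+1)|_{E_{n+1}} = S n`; the restrictions `Z n := S n|_{E_n}` are then compatible and glue by (G3) to `z` on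
`E(ℚ_{∞,v})`; the Coleman congruence of `(T, 0)` at level `n+1` is the first congruence of `S n` (orbit sums only see
the orbit `{gʲc_{n+1}} ⊆ E_{n+1}`), and at level `0` it reads `z(c_0) = 0`, which is (G0) for `S 0`.
[cite: Sprung2012, Def. 5.9 (p. 1495)] -/
theorem hondaBlindGeneratorAtTwo_of_recipe (h0 : LevelZeroBlindVanishingAtTwo) (h1 : LayerwiseBlindSolvabilityAtTwo)
    (h2 : LayerwiseBlindRestrictionAtTwo) (h3 : TowerFunctionalGluingAtTwo) : HondaBlindGeneratorAtTwo := by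
  intro W _ _ hss ha κ hκ v hv g c hg hc hH
  rcases id hH with ⟨cneg, hHc⟩
  have hinj := hHc.2.2.2.2.2.2.2.1
  choose S hS using h1 W hss ha κ hκ v hv g c hg hc hH
  -- the layer inclusions
  have hmono : ∀ n, localLayerPointsOfEmb κ (closureEmb (K := ℚ) (v.adicCompletion ℚ)) W n ≤ localLayerPointsOfEmb κ (closureEmb (K := ℚ) (v.adicCompletion ℚ)) W (n + 1) := fun n =>
    localLayerPointsOfEmb_mono κ (closureEmb (K := ℚ) (v.adicCompletion ℚ)) W (Nat.le_succ n)
  -- (G2) + injectivity: the restriction of `S (n+1)` to `E_{n+1}` is `S n`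
  have hstep : ∀ n, (S (n + 1)).comp (AddSubgroup.inclusion (hmono (n + 1))) = S n := by
    intro n
    have hR := h2 W hss ha κ hκ v hv g c hg hc hH n (S (n + 1)) (hS (n + 1))
    have hSn := hS n
    have key := hinj (n + 1) (Nat.succ_pos n) ((S (n + 1)).comp (AddSubgroup.inclusion (hmono (n + 1))) - S n)
      (by
        rw [pairingSum_sub']
        simpa using dvd_sub hR.1 hSn.1)
      (by
        rw [pairingSum_sub']
        simpa using dvd_sub hR.2 hSn.2)
    exact sub_eq_zero.mp key
  -- the compatible family of restrictions
  obtain ⟨z, hz⟩ := h3 W κ v (fun n => (S n).comp (AddSubgroup.inclusion (hmono n))) (by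
    intro n
    ext x
    have e := DFunLike.congr_fun (hstep n) (AddSubgroup.inclusion (hmono n) x)
    simp only [AddMonoidHom.coe_comp, Function.comp_apply] at e ⊢
    rw [← e])
  refine ⟨z, ?_⟩
  -- value of `z` on a point of the layer `E_{n+1}`
  have hval : ∀ (n : ℕ) (x : localPoints W (v.adicCompletion ℚ)) (hx : x ∈ localLayerPointsOfEmb κ (closureEmb (K := ℚ) (v.adicCompletion ℚ)) W (n + 1)),
      z ⟨x, localLayerPointsOfEmb_le_localTowerPointsOfEmb κ (closureEmb (K := ℚ) (v.adicCompletion ℚ)) W (n + 1) hx⟩ = S n ⟨x, hx⟩ := by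
    intro n x hx
    have e1 := DFunLike.congr_fun (hz (n + 1)) ⟨x, hx⟩
    have e2 := DFunLike.congr_fun (hstep n) ⟨x, hx⟩
    simp only [AddMonoidHom.coe_comp, Function.comp_apply] at e1 e2
    rw [← e2]
    exact e1
  intro n
  cases n with
  | zero =>
    -- level 0: `ω_0 = T`, `u_0 = 0`, and `z(c_0) = S 0 (c_0) = 0` by (G0)
    have hc0 : c 0 ∈ localLayerPointsOfEmb κ (closureEmb (K := ℚ) (v.adicCompletion ℚ)) W (0 + 1) := hmono 0 (hc 0)
    have hz0 : z ⟨c 0, localLayerPointsOfEmb_le_localTowerPointsOfEmb κ (closureEmb (K := ℚ) (v.adicCompletion ℚ)) W (0 + 1) hc0⟩ = 0 := by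
      rw [hval 0 (c 0) hc0, ← evalOn_of_mem W _ (S 0) hc0]
      exact h0 W hss ha κ hκ v hv g c hg hc hH (S 0) (hS 0)
    rw [pairingSum_def]
    simp only [pow_zero, Finset.range_one, Finset.sum_singleton, one_smul, mul_one, sharpPoly_zero, map_zero,
      zero_mul, mul_zero, add_zero]
    rw [evalOn_of_mem W _ z (localLayerPointsOfEmb_le_localTowerPointsOfEmb κ (closureEmb (K := ℚ) (v.adicCompletion ℚ)) W (0 + 1) hc0), hz0, map_zero]
    exact dvd_zero _
  | succ n =>
    rw [mul_zero, add_zero]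
    have e : pairingSum W (localTowerPointsOfEmb κ (closureEmb (K := ℚ) (v.adicCompletion ℚ)) W) g (n + 1) (c (n + 1)) z =
        pairingSum W (localLayerPointsOfEmb κ (closureEmb (K := ℚ) (v.adicCompletion ℚ)) W (n + 1)) g (n + 1) (c (n + 1)) (S n) := by
      refine pairingSum_eq_of_forall_apply_eq W g (n + 1) (c (n + 1)) z (S n) fun j => ?_
      have hb : g ^ j • c (n + 1) ∈ localLayerPointsOfEmb κ (closureEmb (K := ℚ) (v.adicCompletion ℚ)) W (n + 1) :=
        smul_mem_localLayerPointsOfEmb κ (closureEmb (K := ℚ) (v.adicCompletion ℚ)) W (n + 1) (g ^ j) (hc (n + 1))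
      exact ⟨localLayerPointsOfEmb_le_localTowerPointsOfEmb κ (closureEmb (K := ℚ) (v.adicCompletion ℚ)) W (n + 1) hb, hb, hval n _ hb⟩
    rw [e]
    exact (hS n).1

/-- Corollary for the line: with D-imc-72's ★ (`D72BlindGenerator.flatBlindLocalTransversalityHondaOffZeroAtTwo_of_generator
: (G) → (Y) → CDF±_H`), the rung CDF±_H of `Lines/odd_blind_package.lean` §4b follows from (G0)–(G3) and (Y); stated
here only as the conjunction delivered to that theorem's first argument. [cite: Sprung2012, Def. 7.9 (p. 1503)] -/
theorem hondaBlindGeneratorAtTwo_of_recipe' (h : LevelZeroBlindVanishingAtTwo ∧ LayerwiseBlindSolvabilityAtTwo ∧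
    LayerwiseBlindRestrictionAtTwo ∧ TowerFunctionalGluingAtTwo) : HondaBlindGeneratorAtTwo :=
  hondaBlindGeneratorAtTwo_of_recipe h.1 h.2.1 h.2.2.1 h.2.2.2

/-- ★ **The recipe with (G0) discharged: (G1) → (G2) → (G3) → (G)** (kernel-checked; (G0) is
`levelZeroBlindVanishingAtTwo_holds`).  The open content of (G) for a prover is (G1) (size M) plus the two
routine steps (G2) (identities in `Λ`) and (G3) (the tower is the union of its layers).
[cite: Sprung2012, Def. 5.9 (p. 1495)] [cite: Kobayashi2003, Def. 1.1] -/
theorem hondaBlindGeneratorAtTwo_of_recipe₃ (h1 : LayerwiseBlindSolvabilityAtTwo) (h2 : LayerwiseBlindRestrictionAtTwo)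
    (h3 : TowerFunctionalGluingAtTwo) : HondaBlindGeneratorAtTwo :=
  hondaBlindGeneratorAtTwo_of_recipe levelZeroBlindVanishingAtTwo_holds h1 h2 h3

/-- ★ **(G2) holds** — sorry-free, by `isLayerSolution_restrict` and the generic trace relation
`Tr_{n+2/n+1} c_{n+2} = a₂ c_{n+1} − c_n` (the fifth clause of `IsHondaSystemAtTwo`).
[cite: Sprung2012, Prop. 5.5 (p. 1494), Def. 5.9 (p. 1495)] [cite: Sprung2017, Cor. 4.4] -/
theorem layerwiseBlindRestrictionAtTwo_holds : LayerwiseBlindRestrictionAtTwo := by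
  intro W _ _ _ _ κ _ v _ g c hg hc hH n z hz
  obtain ⟨cneg, hHc⟩ := hH
  have hTR := hHc.2.2.2.2.1 (n + 1) (by omega)
  rw [Nat.add_sub_cancel] at hTR
  exact isLayerSolution_restrict κ (closureEmb (K := ℚ) (v.adicCompletion ℚ)) W hg hc n hTR z hz

/-- ★ **The recipe with (G0) and (G3) discharged: (G1) → (G2) → (G)** (kernel-checked; (G3) is
`towerFunctionalGluingAtTwo_holds`).  The open content of (G) for a prover is (G1) (size M) plus the routine (G2)
(level raising `P_{n+2}(z;x) = Φ_{n+2}·P_{n+1}(z;x)` for `x` in layer `n+1` and trace compatibility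
`P_{n+1}(z; Tr_{n+2/n+1} y) ≡ P_{n+2}(z; y) (mod ω_{n+1})`, both proved in the tree for TOWER functionals as
`Sprung2012.thetaPoly_succ_of_mem_layer` / `Sprung2012.omega_dvd_thetaPoly_succ_sub` (`ColemanPairExistsProofs`) — the same
`Finset` proofs apply verbatim to layer functionals — plus Sprung's recursion `u_{n+2} = a₂u_{n+1} − Φ_{n+1}u_n`, tree `sprungSeq`).
[cite: Sprung2012, Prop. 5.5 (p. 1494), Def. 5.9 (p. 1495)] [cite: Sprung2017, Cor. 4.4] -/
theorem hondaBlindGeneratorAtTwo_of_recipe₂ (h1 : LayerwiseBlindSolvabilityAtTwo) (h2 : LayerwiseBlindRestrictionAtTwo) :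
    HondaBlindGeneratorAtTwo :=
  hondaBlindGeneratorAtTwo_of_recipe levelZeroBlindVanishingAtTwo_holds h1 h2 towerFunctionalGluingAtTwo_holds

/-- ★★ **(G1) → (G)**: with (G0), (G2), (G3) all discharged in this file, the blind-kernel generator (G) — hence
CDF±_H via D-imc-72 ★ `(G) → (Y) → CDF±_H` — reduces to the single layerwise solvability statement (G1)
`LayerwiseBlindSolvabilityAtTwo` (kernel-checked). [cite: Sprung2012, Thm. 2.2 (p. 1487), Def. 3.1, Def. 5.9] [cite: Kobayashi2003, Def. 1.1]
[cite: Sprung2017, Cor. 4.4] -/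
theorem hondaBlindGeneratorAtTwo_of_layerwiseBlindSolvability (h1 : LayerwiseBlindSolvabilityAtTwo) :
    HondaBlindGeneratorAtTwo :=
  hondaBlindGeneratorAtTwo_of_recipe levelZeroBlindVanishingAtTwo_holds h1 layerwiseBlindRestrictionAtTwo_holds
    towerFunctionalGluingAtTwo_holds

end D73GeneratorRecipe

end Summit.BirchSwinnertonDyer.BirchSwinnertonDyer.Cruxes.SupersingularRankZeroAtTwo

end
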